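import Summits.QuantumFields.BalabanUV.Beta.FP.StepDefectInherit

/-!
# `BalabanUV.Beta.FP.NestedStepLawAssemblyFactors` — road «FP» for binder row D1, RULING R-FP-48 row **ASSEMBLY′** (owner, gen 16; memo `N2B-DESIGN.md` v4.0 §15,
# statement-first): THE KERNEL-LEVEL STEP LAW `TP (m+1) = RP m + TP m` FROM THE ROWS OF THE **FACTOR** ARCHITECTURE — SLOT′∕FACTOR (`TP (m+1) = FINE m + BLOCK m`,
# the two determinant factors' one-loop kernels), TRANSPORT′ (`FINE m = U m · RP♭ m + CROSS m`, the fine factor along the coarse minimiser: transport with its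
# UNITS LETTER displayed, plus the tadpole cross term), UNLIFT′ (`BLOCK m = TP m`), TAD (`CROSS m = 0`) — hence `StepDefectInherit.defect TP RP m = 0` and the END's
# `hSDF` in EVERY channel

HONEST DEPENDENCY (page 1, mandatory): continuum YM on T⁴ ⇐ BetaPertH ∧ nine spine estimates (0/9 proved); BetaPertH ⇐ (D1) ∧ (D4) ∧ CAP+tail;
G-an2-4 gates asym, D1 and NE2/3/4.  HONEST FRAMING (cell contract, verbatim): «discharging `BetaPertH` makes Bałaban's UV stability UNCONDITIONAL —
a real constructive-QFT result; it is NOT the continuum limit and NOT the Clay problem.»  THIS MODULE is [our object] COMPOSITION BY NAME over ABSTRACT letters: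
the rows of RULING R-FP-48 enter as HYPOTHESES (each a swarm row with a named holder; the MODEL of SLOT′∕FACTOR is kernel-checked: `FP/NestedStepLawMovingBorder`
✓ p302005, `FP/EffectiveFormJetsMovingBorder`; TAD is `FP/TadpoleFreeVertex` ✓ ∕ `FP/TadpoleFreePerfect` ✓); no `def`, no `def … : Prop`, nothing cited, 0 sorry.
It DISCHARGES NOTHING by itself: 0∕4 row-D1 binders; NOT SDF for the literal until SLOT′ ∕ TRANSPORT′ ∕ UNLIFT′ land at the perfect objects, NOT D1, NOT BetaPertH,
NOT continuum, NOT Clay.  «not in print; our bookkeeping».  It SUPERSEDES NOTHING: `FP/NestedStepLawAssembly` (gen 15, resolvent-piece cut) stays true algebra; by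
R-FP-48 it is not the shape instantiated at the literal (its `htransport` over the COMPOSITE jets is not `RP + CROSS` when the borders move).

ABSOLUTE RULE (cell charter, verbatim): «No internally-minted statement may enter as a cited fact. Every hypothesis is either kernel-proved in this package or a
verbatim quotation of a PUBLISHED theorem with page reference. The manuscript(s) under audit are NOT citable for their own disputed steps — they are the thing
under adjudication; programme-internal (2001/route/tribunal) claims are never citable.»

THE SHAPE (memo §15 (15c); level `m+1`).  `hfactor` (rows SLOT′ + FACTOR, kernel instance of `NestedStepLawMovingBorder.sixLoops_nestedStepLaw_movingBorder`): the END's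
`TP (m+1)` is the sum of the FINE factor's one-loop kernel `FINE m` (one-step resolvent, one-step bordered jets nested with the coarse minimiser columns) and the
BLOCK factor's `BLOCK m` (effective form + lifted multiplier family, coarse border).  `htransport` (row TRANSPORT′, leaf-02 `TransportFineFactor`): `FINE m = U m · RP♭ m +
CROSS m` where `RP♭ m` is the UNIT-FREE transport `dressedEntry (colOf (KPerf m)) (TP 1) ((Lc^m)•z)` and `U m` the DISPLAYED units scalar (Q-FP-16-3: the END's `RP m`
is `(Lc^m)⁸ · RP♭ m`; the scalar is produced by SLOT′'s unit-rescaled objects, not by the transport identity) — so the END's `RP` is `fun m a b z => U m * RP♭ m a b z`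
and the hypothesis `hRP` pins it; `CROSS m` is the `T₁`-linear word.  `hunlift` (row UNLIFT′): `BLOCK m = TP m`.  `htad` (row TAD): `CROSS m = 0`.
CONCLUSION: `TP (m+1) = RP m + TP m` pointwise, `defect TP RP m = 0`, `secondMoment (defect TP RP m) μ ν = 0` for every `μ ν`.

CONTENTS: `stepLaw_kernel_of_factor_rows`, `defect_eq_zero_of_factor_rows`, `secondMoment_defect_eq_zero_of_factor_rows`.
Provenance: road FP OWNER b2b-balaban-beta-d1-p3 gen 16 (prover-b2b-balaban-beta-d1-p3-g16-0), 2026-08-21; RULING R-FP-48 ∕ memo §15.  GENERIC index type `D`.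
-/

noncomputable section

namespace Summit.QuantumFields.BalabanUV.Beta.FP.NestedStepLawAssemblyFactors

open Literature.MathematicalPhysics.QuantumFieldTheory.Balaban1983to89
open Literature.MathematicalPhysics.QuantumFieldTheory.Balaban1983to89.Beta
open Summit.QuantumFields.BalabanUV.Beta.FP.StepDefectInherit (defect)

variable {D : ℕ}

/-- [our object] **THE KERNEL-LEVEL STEP LAW FROM THE FACTOR ROWS**.  Data per `m`: the END's kernels `TP`, `RP`, the two factors' kernels `FINE`, `BLOCK`, the unit-free
transport `RPflat`, the units scalar `U`, the cross term `CROSS`.  Rows: `hfactor` (`TP (m+1) = FINE m + BLOCK m`), `hRP` (`RP m = U m · RPflat m`), `htransport`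
(`FINE m = U m · RPflat m + CROSS m`), `hunlift` (`BLOCK m = TP m`), `htad` (`CROSS m = 0`).  CONCLUSION: `TP (m+1) a b z = RP m a b z + TP m a b z`. -/
theorem stepLaw_kernel_of_factor_rows {TP RP FINE BLOCK RPflat CROSS : ℕ → Fin D → Fin D → (Fin D → ℤ) → ℝ} {U : ℕ → ℝ}
    (hfactor : ∀ m, 1 ≤ m → ∀ a b z, TP (m + 1) a b z = FINE m a b z + BLOCK m a b z)
    (hRP : ∀ m, 1 ≤ m → ∀ a b z, RP m a b z = U m * RPflat m a b z)
    (htransport : ∀ m, 1 ≤ m → ∀ a b z, FINE m a b z = U m * RPflat m a b z + CROSS m a b z)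
    (hunlift : ∀ m, 1 ≤ m → ∀ a b z, BLOCK m a b z = TP m a b z)
    (htad : ∀ m, 1 ≤ m → ∀ a b z, CROSS m a b z = 0)
    {m : ℕ} (hm : 1 ≤ m) (a b : Fin D) (z : Fin D → ℤ) :
    TP (m + 1) a b z = RP m a b z + TP m a b z := by
  rw [hfactor m hm, htransport m hm, hunlift m hm, htad m hm, hRP m hm, add_zero]

/-- [our object] **THE EXPLICIT FIXED-POINT DEFECT VANISHES AS A KERNEL** under the factor rows: `StepDefectInherit.defect TP RP m = 0` for every `m ≥ 1`. -/
theorem defect_eq_zero_of_factor_rows {TP RP FINE BLOCK RPflat CROSS : ℕ → Fin 4 → Fin 4 → (Fin 4 → ℤ) → ℝ} {U : ℕ → ℝ}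
    (hfactor : ∀ m, 1 ≤ m → ∀ a b z, TP (m + 1) a b z = FINE m a b z + BLOCK m a b z)
    (hRP : ∀ m, 1 ≤ m → ∀ a b z, RP m a b z = U m * RPflat m a b z)
    (htransport : ∀ m, 1 ≤ m → ∀ a b z, FINE m a b z = U m * RPflat m a b z + CROSS m a b z)
    (hunlift : ∀ m, 1 ≤ m → ∀ a b z, BLOCK m a b z = TP m a b z)
    (htad : ∀ m, 1 ≤ m → ∀ a b z, CROSS m a b z = 0)
    {m : ℕ} (hm : 1 ≤ m) : defect TP RP m = 0 := by
  funext a b z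
  show TP (m + 1) a b z - RP m a b z - TP m a b z = 0
  rw [stepLaw_kernel_of_factor_rows hfactor hRP htransport hunlift htad hm a b z]
  ring

/-- [our object] **THE END's `hSDF` SHAPE, EVERY CHANNEL** under the factor rows: `B12Beta.secondMoment (defect TP RP m) μ ν = 0` for all `m ≥ 1`, `μ`, `ν` — the binder of
`RoadLeftAssemblySDF.d1Drift_left_of_sliceLedger_sdf` ∕ `StepLawLeft.stepLaw_left_of_ward_symm_explicitDefect` with SLOT′∕FACTOR ∕ TRANSPORT′ ∕ UNLIFT′ ∕ TAD in place of one
opaque hypothesis. -/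
theorem secondMoment_defect_eq_zero_of_factor_rows {TP RP FINE BLOCK RPflat CROSS : ℕ → Fin 4 → Fin 4 → (Fin 4 → ℤ) → ℝ} {U : ℕ → ℝ}
    (hfactor : ∀ m, 1 ≤ m → ∀ a b z, TP (m + 1) a b z = FINE m a b z + BLOCK m a b z)
    (hRP : ∀ m, 1 ≤ m → ∀ a b z, RP m a b z = U m * RPflat m a b z)
    (htransport : ∀ m, 1 ≤ m → ∀ a b z, FINE m a b z = U m * RPflat m a b z + CROSS m a b z)
    (hunlift : ∀ m, 1 ≤ m → ∀ a b z, BLOCK m a b z = TP m a b z)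
    (htad : ∀ m, 1 ≤ m → ∀ a b z, CROSS m a b z = 0) :
    ∀ m : ℕ, 1 ≤ m → ∀ μ ν : Fin 4, B12Beta.secondMoment (defect TP RP m) μ ν = 0 := by
  intro m hm μ ν
  rw [defect_eq_zero_of_factor_rows hfactor hRP htransport hunlift htad hm]
  simp [B12Beta.secondMoment]

end Summit.QuantumFields.BalabanUV.Beta.FP.NestedStepLawAssemblyFactors

end
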